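/-
Origin: expansion seat `planner-pub-hodgecm-pv04-g6-0`, handover #2 2026-08-18T09:23:06Z (`HOME/pub-hodgecm-pv04-g6/lean/Pv04g6/CMInflationIndependent.lean`, md5 8f5e7032, 382 lines);
landed by the gen-7 packager in gate run 27 as `HodgeCM/Model/Toy/CMInflationIndependent.lean` (import ^import Pv04g6\.RestrictMor\b→import HodgeCM.Model.RestrictMor ×1).
-/
/-
Copyright: pub-hodgecm cell (HodgeCMPerL). Consistency-witness layer (part (e)); FACTS.md §1c row (M38), column P5.
Origin: HOME/pub-hodgecm-pv04-g6/lean/Pv04g6/CMInflationIndependent.lean (WIP module `Pv04g6.CMInflationIndependent`; intended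
final place `HodgeCM/Model/Toy/CMInflationIndependent.lean` = module `HodgeCM.Model.Toy.CMInflationIndependent`, CONTRIBUTING §3
kind L5) (seat planner-pub-hodgecm-pv04-g6-0, DAG-node prover #04 gen 6, seam S6 / fact row M38).
WIP import to rewrite on landing: `import Pv04g6.RestrictMor` ↦ `import HodgeCM.Model.RestrictMor`.
-/
import Summits.HodgeConjecture.HodgeCM.Model.RestrictMor
import Summits.HodgeConjecture.HodgeCM.Model.Toy.CMInflation

/-!
# M38 `Fact_cmInflation` is independent of `ModelAxioms`

`HOME/FACTS.md` §1c row (M38) = `Universe.Fact_cmInflation` (`HodgeCM.PerL34.ThetaSubOfLiu`): for a CM subfield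
`k : K ↪ M` and a CM type `Φ` of `K`, `H¹(A_{(M,Φ^M)}, ℚ) ≅ ⊕ⱼ pⱼ^* H¹(A_{(K,Φ)}, ℚ)` `K`-equivariantly for finitely
many morphisms `pⱼ : A_{(M,Φ^M)} → A_{(K,Φ)}`.  Its WITNESS column is `HodgeCM.Toy.fact_cmInflation` (run 22: M38
holds in `toyModel`).  This file supplies the INDEPENDENCE column:

* `tagModel_modelAxioms` / `not_fact_cmInflation`: a universe satisfying all of `ModelAxioms` (M1–M28) in which
  M38 FAILS; hence `cmInflation_independent : ∃ U, U.ModelAxioms ∧ ¬ U.Fact_cmInflation` and, with the run-22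
  witness, `cmInflation_undecided` (both `M38` and `¬ M38` are consistent with `ModelAxioms`).

## The model

`tagModel D = (toyModelWith D).restrict (tagClass D)` (`HodgeCM.Universe.restrict`, module `RestrictMor`): the toy
universe with the same varieties, cohomology, Hodge structures, algebraic classes, CM objects and CM actions, but
with FEWER MORPHISMS — only the lattice maps that are **tagged**: every atom `A` of a toy object carries the tag
`tag(A) := normalClosure_ℚ(A.F) · ℚ(ζ₇) ⊂ ℂ` (the Galois hull of its field composed with the seventh cyclotomic
field), and a lattice map is tagged when it maps, for every `τ`, the vectors supported on atoms of tag `τ` to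
vectors supported on atoms of tag `τ`.  Identities, composites, the product projections and pairings, every
endomorphism of a CM object, the conjugation isogenies and — the point — the domination maps `s`, `π` of M17
between `A_{(K,Φ)}` and `A_{(N_K, Φ^{N_K})}` (`N_K = HodgeCM.Toy.GaloisClosure.N K`, the oracle's Galois CM field)
are tagged, because `tag(FK K) = N_K = tag(N_K)` (`tagOf_FK`, `tagOf_N`).  So M17/M18/M24/M25 hold in `tagModel`,
and the 24 universally quantified axioms restrict (`Universe.ModelAxioms.restrict`).

M38 fails for `K₀ = ℚ(ζ₇) ⊂ M₀ = ℚ(ζ₄₉)` (both CM: Mathlib `IsCyclotomicExtension.Rat.isCMField`): the tags are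
`ℚ(ζ₇)` (degree 6) and a field containing `ℚ(ζ₄₉)` (degree 42), so every tagged morphism
`A_{(M₀,Φ^{M₀})} → A_{(K₀,Φ)}` pulls `H¹` back by zero, and no finite sum of such pull-backs is onto
`H¹(A_{(M₀,Φ^{M₀})}) ≅ ℚ(ζ₄₉) ≠ 0`.

Consumer census (pv01-g5, STATUS 09:10:52Z/09:11:02Z): at the END-STATE level `hM38` is read only through seam S6
(`PerL34.thetaAlbanese_iff_open`, records ⇒ leaves, `EndStateCensus.dictLeaves_of_headlineBundle`); PerL from the
dictionary leaves is `hM38`-free (`EndStateCensus.perL_of_dictLeaves`).  So this file certifies that the one class-M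
fact of S6 is a genuinely additional hypothesis on the model layer, neither provable nor refutable from M1–M28.

Nothing is cited; no `Prop`-valued hypothesis is introduced (class K, kernel facts about the toy model).
Companion generic file: `HodgeCM.Model.RestrictMor` (`Universe.MorClass`, `Universe.restrict`,
`Universe.ModelAxioms.restrict`).
-/

noncomputable section

namespace HodgeCM.Toy

open Literature.AlgebraicGeometry.Motives
open CMPresentation GaloisClosure IntermediateField Polynomial exteriorPower
open CMTypeOps (inflate)

namespace CMInflationIndependent

/-! ### Tags -/

/-- The **tag** of a subfield `E ⊂ ℂ` of finite degree: the Galois hull of `E` inside `ℂ` composed with `ℚ(ζ₇)`. -/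
def tagOf (E : IntermediateField ℚ ℂ) : IntermediateField ℚ ℂ := normalClosure ℚ E ℂ ⊔ ℚ⟮ζ⟯

/-- (Ported verbatim from the HodgeCMPerL package; no docstring in the source.) -/
lemma le_tagOf (E : IntermediateField ℚ ℂ) : E ≤ tagOf E := (le_normalClosure E).trans le_sup_left

/-- (Ported verbatim from the HodgeCMPerL package; no docstring in the source.) -/
lemma adjoin_ζ_le_N (K : CMField) : ℚ⟮ζ⟯ ≤ N K :=
  adjoin_simple_le_iff.mpr (subset_adjoin ℚ (S K) (ζ_mem_S K))

/- NOTE on instances.  For `E : IntermediateField ℚ ℂ`, elaboration in this file resolves `Algebra ℚ ↥E` to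
`DivisionRing.toRatAlgebra`, whereas Mathlib's lemmas about `↥E` are stated over `IntermediateField.algebra'`; the
two agree by `rfl` but not reducibly, so such lemmas are invoked below with `@` and an explicitly supplied `Normal`
instance, and restated by a type ascription (never by `rw` with the Mathlib form). -/

/-- `normalClosure` of a normal subfield, in this file's instance path. -/
lemma normalClosure_eq_self (E : IntermediateField ℚ ℂ) (hE : Normal ℚ E) : normalClosure ℚ E ℂ = E :=
  @IntermediateField.normalClosure_of_normal ℚ ℂ _ _ _ E hE

/-- `AlgHom.fieldRange_of_normal`, in this file's instance path. -/
lemma fieldRange_eq_self (E : IntermediateField ℚ ℂ) (hE : Normal ℚ E) (f : E →ₐ[ℚ] ℂ) : f.fieldRange = E :=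
  @AlgHom.fieldRange_of_normal ℚ ℂ _ _ _ E hE f

/-- `tag(N_K) = N_K`. -/
lemma tagOf_N (K : CMField) : tagOf (N K) = N K := by
  rw [tagOf, normalClosure_eq_self (N K) (GaloisClosure.normal K), sup_eq_left]
  exact adjoin_ζ_le_N K

/-- The presentation `FK` of the oracle's Galois CM field `N_K` is `N_K` itself. -/
lemma FK_galoisCM (K : CMField) : FK (galoisCM K) = N K :=
  fieldRange_eq_self (N K) (GaloisClosure.normal K) (σ₀ (galoisCM K))

/-- **`tag(FK K) = N_K`**: the Galois hull of (the chosen complex image of) `K` composed with `ℚ(ζ₇)` is the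
oracle's field `N_K = ℚ(roots of minpoly(θ_K) · Φ₇)`. -/
lemma tagOf_FK (K : CMField) : tagOf (FK K) = N K := by
  apply le_antisymm
  · refine sup_le (normalClosure_le_iff.mpr fun ψ => ?_) (adjoin_ζ_le_N K)
    intro x hx
    obtain ⟨y, rfl⟩ := AlgHom.mem_fieldRange.mp hx
    obtain ⟨z, rfl⟩ := (eK K).surjective y
    exact apply_mem K (ψ.toRingHom.comp (eK K : K →+* FK K)) z
  · refine adjoin_le_iff.mpr fun z hz => ?_
    rcases (mem_S_iff K).mp hz with h | h
    · -- `z` is a complex conjugate of the primitive element `θ_K`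
      let φ : K →ₐ[ℚ] ℂ := (pb K).lift z h
      have hφ : φ (pb K).gen = z := (pb K).lift_gen z h
      let ψ : FK K →ₐ[ℚ] ℂ := φ.comp ((eK K).symm : FK K →ₐ[ℚ] K)
      have hmem : z ∈ ψ.fieldRange := AlgHom.mem_fieldRange.mpr ⟨eK K (pb K).gen, by simp [ψ, hφ]⟩
      exact (le_sup_left : normalClosure ℚ (FK K) ℂ ≤ tagOf (FK K)) (ψ.fieldRange_le_normalClosure hmem)
    · -- `z` is a primitive seventh root of unity, a power of `ζ`
      have hz7 : IsPrimitiveRoot z 7 := by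
        rw [aeval_def, ← eval_map, map_cyclotomic] at h
        exact isRoot_cyclotomic_iff.mp h
      obtain ⟨i, -, rfl⟩ := ζ_prim.eq_pow_of_pow_eq_one hz7.pow_eq_one
      exact (le_sup_right : ℚ⟮ζ⟯ ≤ tagOf (FK K)) (pow_mem (mem_adjoin_simple_self ℚ ζ) i)

/-- The atom of `A_{(K,Φ)}` has tag `N_K` … -/
lemma tag_cmObj (K : CMField) (Φ : CMType K) (u : Unit) : tagOf ((cmObj K Φ).atom u).F = N K := tagOf_FK K

/-- … and so has the atom of `A_{(N_K,Ψ)}`. -/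
lemma tag_cmObj_galoisCM (K : CMField) (Ψ : CMType (galoisCM K)) (u : Unit) :
    tagOf ((cmObj (galoisCM K) Ψ).atom u).F = N K := by
  change tagOf (FK (galoisCM K)) = N K
  rw [FK_galoisCM, tagOf_N]

/-! ### Tagged lattice maps -/

variable {X Y Z : Obj}

/-- The `τ`-part of the lattice of `X`: the vectors supported on the atoms of tag `τ`. -/
def part (X : Obj) (τ : IntermediateField ℚ ℂ) : Submodule ℚ X.L where
  carrier := {x | ∀ i, tagOf (X.atom i).F ≠ τ → x i = 0}
  add_mem' hx hy i hi := by simp [hx i hi, hy i hi]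
  zero_mem' _ _ := rfl
  smul_mem' c x hx i hi := by simp [hx i hi]

/-- (Ported verbatim from the HodgeCMPerL package; no docstring in the source.) -/
lemma mem_part {τ : IntermediateField ℚ ℂ} {x : X.L} :
    x ∈ part X τ ↔ ∀ i, tagOf (X.atom i).F ≠ τ → x i = 0 := Iff.rfl

/-- A map of toy objects is **tagged** if its lattice map sends every `τ`-part into the `τ`-part. -/
def Tagged (f : Obj.Hom X Y) : Prop := ∀ (τ : IntermediateField ℚ ℂ) (y : Y.L), y ∈ part Y τ → f.lin y ∈ part X τ

/-- (Ported verbatim from the HodgeCMPerL package; no docstring in the source.) -/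
lemma tagged_id (X : Obj) : Tagged (Obj.Hom.id X) := fun _ _ hy => hy

/-- (Ported verbatim from the HodgeCMPerL package; no docstring in the source.) -/
lemma tagged_comp {f : Obj.Hom X Y} {g : Obj.Hom Y Z} (hf : Tagged f) (hg : Tagged g) :
    Tagged (f.comp g) := fun τ z hz => hf τ _ (hg τ z hz)

/-- (Ported verbatim from the HodgeCMPerL package; no docstring in the source.) -/
lemma tagged_fst (X Y : Obj) : Tagged (Obj.fst X Y) := by
  intro τ x hx
  rintro (i | i) hi
  · change X.inlL Y x (Sum.inl i) = 0
    rw [Obj.inlL_apply_inl]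
    exact hx i hi
  · exact Obj.inlL_apply_inr x i

/-- (Ported verbatim from the HodgeCMPerL package; no docstring in the source.) -/
lemma tagged_snd (X Y : Obj) : Tagged (Obj.snd X Y) := by
  intro τ y hy
  rintro (i | i) hi
  · exact Obj.inrL_apply_inl y i
  · change X.inrL Y y (Sum.inr i) = 0
    rw [Obj.inrL_apply_inr]
    exact hy i hi

/-- (Ported verbatim from the HodgeCMPerL package; no docstring in the source.) -/
lemma tagged_lift {f : Obj.Hom Z X} {g : Obj.Hom Z Y} (hf : Tagged f) (hg : Tagged g) :
    Tagged (Obj.lift f g) := by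
  intro τ w hw
  have h1 : (X.sumEquiv Y w).1 ∈ part X τ := fun i hi => hw (Sum.inl i) hi
  have h2 : (X.sumEquiv Y w).2 ∈ part Y τ := fun i hi => hw (Sum.inr i) hi
  have : (Obj.lift f g).lin w = f.lin (X.sumEquiv Y w).1 + g.lin (X.sumEquiv Y w).2 := by
    change (f.lin.coprod g.lin) (X.sumEquiv Y w) = _
    rw [LinearMap.coprod_apply]
  rw [this]
  exact (part Z τ).add_mem (hf τ _ h1) (hg τ _ h2)

/-- A map between two objects all of whose atoms carry one and the same tag is tagged. -/
lemma tagged_of_const (f : Obj.Hom X Y) (τ₀ : IntermediateField ℚ ℂ)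
    (hX : ∀ i, tagOf (X.atom i).F = τ₀) (hY : ∀ j, tagOf (Y.atom j).F = τ₀) : Tagged f := by
  intro τ y hy i hi
  have hne : τ₀ ≠ τ := fun h => hi (by rw [hX i, h])
  have hy0 : y = 0 := funext fun j => hy j (by rw [hY j]; exact hne)
  rw [hy0, map_zero]
  rfl

/-! ### The tagged toy universe and its model axioms -/

variable (D : HodgeData)

/-- The tagged maps as a morphism class of the toy universe. -/
def tagClass : (toyModelWith D).MorClass where
  P f := Tagged f
  id_mem X := tagged_id X
  comp_mem _ _ hf hg := tagged_comp hf hg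
  fst_mem X Y := tagged_fst X Y
  snd_mem X Y := tagged_snd X Y

/-- **The tagged toy universe** (reducible, so that its fields compute). -/
@[reducible] def tagModel : Universe := (toyModelWith D).restrict (tagClass D)

/-- M18 in the tagged universe: the pairing of tagged maps is tagged. -/
theorem tag_fact_lift : (tagModel D).Fact_lift := fun _ _ _ f g =>
  ⟨⟨Obj.lift f.1 g.1, tagged_lift f.2 g.2⟩, Subtype.ext (Obj.lift_comp_fst f.1 g.1),
    Subtype.ext (Obj.lift_comp_snd f.1 g.1)⟩

/-- M24 in the tagged universe: every endomorphism of `A_{(K,Φ)}` is tagged. -/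
theorem tag_fact_cmEnd : (tagModel D).Fact_cmEnd := fun K Φ a => by
  obtain ⟨e, he⟩ := HodgeCM.Toy.fact_cmEnd D K Φ a
  exact ⟨⟨e, tagged_of_const e (N K) (tag_cmObj K Φ) (tag_cmObj K Φ)⟩, he⟩

/-- M25 in the tagged universe: every map `A_{(K,Φ)} → A_{(K,Φ')}` is tagged. -/
theorem tag_fact_conjIsogeny : (tagModel D).Fact_conjIsogeny := fun K Φ Φ' h => by
  obtain ⟨u, hu⟩ := HodgeCM.Toy.fact_conjIsogeny D K Φ Φ' h
  exact ⟨⟨u, tagged_of_const u (N K) (tag_cmObj K Φ) (tag_cmObj K Φ')⟩, hu⟩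

/-- M17 in the tagged universe: the domination maps `s`, `π` between `A_{(K,Φ)}` and `A_{(N_K, Φ^{N_K})}` of the
toy (`sHom`, `piHom`, from the discharged oracle `galoisCMOracle`) are tagged, since `tag(FK K) = N_K = tag(N_K)`. -/
theorem tag_fact_cmDominated : (tagModel D).Fact_cmDominated := by
  rintro X ⟨K, Φ, rfl⟩
  refine ⟨galoisCMOracle.F K, galoisCMOracle.gal K, galoisCMOracle.six K, 0,
    fun _ => inducedType K (galoisCMOracle.F K) (galoisCMOracle.emb K) Φ,
    ⟨sHom K (galoisCMOracle.F K) (galoisCMOracle.emb K) Φ,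
      tagged_of_const _ (N K) (tag_cmObj K Φ) (tag_cmObj_galoisCM K _)⟩,
    ⟨piHom K (galoisCMOracle.F K) (galoisCMOracle.emb K) Φ,
      tagged_of_const _ (N K) (tag_cmObj_galoisCM K _) (tag_cmObj K Φ)⟩,
    1, one_ne_zero, fun k => ?_⟩
  change map k ((sHom K (galoisCMOracle.F K) (galoisCMOracle.emb K) Φ).comp
    (piHom K (galoisCMOracle.F K) (galoisCMOracle.emb K) Φ)).lin = _
  rw [sHom_comp_piHom, Nat.cast_one, one_pow, one_smul]
  exact map_id

/-- **All of `ModelAxioms` (M1–M28) hold in the tagged toy universe** (displaying, like `toyModel_axioms_of`, the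
dependence on a Galois-CM-closure oracle and on M28 for the Hodge datum `D`). -/
theorem tagModel_axioms_of (O : GaloisCMOracle) (h28 : (toyModelWith D).Fact_algDuality) :
    (tagModel D).ModelAxioms :=
  (toyModel_axioms_of D O h28).restrict (tagClass D) (tag_fact_cmDominated D) (tag_fact_lift D)
    (tag_fact_cmEnd D) (tag_fact_conjIsogeny D)

/-- `ModelAxioms` for the tagged EXTERIOR toy universe, unconditionally. -/
theorem tagModel_modelAxioms : (tagModel exteriorHodgeData).ModelAxioms :=
  tagModel_axioms_of exteriorHodgeData galoisCMOracle fact_algDuality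

/-! ### Separation: `ℚ(ζ₇) ⊂ ℚ(ζ₄₉)` -/

/-- A primitive 49th root of unity in `ℂ`. -/
def ζ49 : ℂ := Complex.exp (2 * Real.pi * Complex.I / 49)

/-- (Ported verbatim from the HodgeCMPerL package; no docstring in the source.) -/
lemma ζ49_prim : IsPrimitiveRoot ζ49 49 := by
  simpa [ζ49] using Complex.isPrimitiveRoot_exp 49 (by norm_num)

/-- (Ported verbatim from the HodgeCMPerL package; no docstring in the source.) -/
lemma ζ49_pow_seven : ζ49 ^ 7 = ζ := by
  rw [ζ49, ζ, ← Complex.exp_nat_mul]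
  congr 1
  push_cast
  ring

/-- `ℚ(μ) ⊂ ℂ` is a cyclotomic extension for a primitive root of unity `μ`
(cf. Mathlib `IsPrimitiveRoot.intermediateField_adjoin_isCyclotomicExtension`, which wants `ℂ/ℚ` integral). -/
lemma adjoin_isCyclotomicExtension {n : ℕ} [NeZero n] {μ : ℂ} (hμ : IsPrimitiveRoot μ n) :
    IsCyclotomicExtension {n} ℚ ℚ⟮μ⟯ := by
  change IsCyclotomicExtension {n} ℚ ℚ⟮μ⟯.toSubalgebra
  rw [adjoin_simple_toSubalgebra_of_isAlgebraic ((hμ.isIntegral (NeZero.pos n)).tower_top.isAlgebraic)]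
  exact hμ.adjoin_isCyclotomicExtension ℚ

/-- `ℚ(ζ₇) ⊂ ℂ` -/
abbrev Q7 : IntermediateField ℚ ℂ := ℚ⟮ζ⟯
/-- `ℚ(ζ₄₉) ⊂ ℂ` -/
abbrev Q49 : IntermediateField ℚ ℂ := ℚ⟮ζ49⟯

/-- (Ported verbatim from the HodgeCMPerL package; no docstring in the source.) -/
instance : IsCyclotomicExtension {7} ℚ Q7 := adjoin_isCyclotomicExtension ζ_prim
/-- (Ported verbatim from the HodgeCMPerL package; no docstring in the source.) -/
instance : IsCyclotomicExtension {49} ℚ Q49 := adjoin_isCyclotomicExtension ζ49_prim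
/-- (Ported verbatim from the HodgeCMPerL package; no docstring in the source.) -/
instance : FiniteDimensional ℚ Q7 := adjoin.finiteDimensional ((ζ_prim.isIntegral (by norm_num)).tower_top)
/-- (Ported verbatim from the HodgeCMPerL package; no docstring in the source.) -/
instance : FiniteDimensional ℚ Q49 := adjoin.finiteDimensional ((ζ49_prim.isIntegral (by norm_num)).tower_top)
/-- (Ported verbatim from the HodgeCMPerL package; no docstring in the source.) -/
instance : NumberField Q7 := NumberField.mk
/-- (Ported verbatim from the HodgeCMPerL package; no docstring in the source.) -/
instance : NumberField Q49 := NumberField.mk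
/-- (Ported verbatim from the HodgeCMPerL package; no docstring in the source.) -/
instance : IsGalois ℚ Q7 := IsCyclotomicExtension.isGalois {7} ℚ Q7
/-- (Ported verbatim from the HodgeCMPerL package; no docstring in the source.) -/
instance : IsGalois ℚ Q49 := IsCyclotomicExtension.isGalois {49} ℚ Q49
/-- (Ported verbatim from the HodgeCMPerL package; no docstring in the source.) -/
instance : NumberField.IsCMField Q7 :=
  IsCyclotomicExtension.Rat.isCMField Q7 (S := {7}) ⟨7, Set.mem_singleton _, by norm_num⟩
/-- (Ported verbatim from the HodgeCMPerL package; no docstring in the source.) -/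
instance : NumberField.IsCMField Q49 :=
  IsCyclotomicExtension.Rat.isCMField Q49 (S := {49}) ⟨49, Set.mem_singleton _, by norm_num⟩

/-- the CM field `K₀ = ℚ(ζ₇)` -/
def K7 : CMField := ⟨Q7⟩
/-- the CM field `M₀ = ℚ(ζ₄₉)` -/
def K49 : CMField := ⟨Q49⟩

/-- (Ported verbatim from the HodgeCMPerL package; no docstring in the source.) -/
lemma Q7_le_Q49 : Q7 ≤ Q49 :=
  adjoin_simple_le_iff.mpr (by rw [← ζ49_pow_seven]; exact pow_mem (mem_adjoin_simple_self ℚ ζ49) 7)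

/-- the inclusion `k₀ : ℚ(ζ₇) ↪ ℚ(ζ₄₉)` -/
def k₀ : K7 →+* K49 := (IntermediateField.inclusion Q7_le_Q49).toRingHom

/-- (Ported verbatim from the HodgeCMPerL package; no docstring in the source.) -/
lemma finrank_Q49 : Module.finrank ℚ Q49 = 42 := by
  rw [adjoin.finrank ((ζ49_prim.isIntegral (by norm_num)).tower_top),
    ← cyclotomic_eq_minpoly_rat ζ49_prim (by norm_num), natDegree_cyclotomic,
    show (49 : ℕ) = 7 ^ 2 from rfl, Nat.totient_prime_pow (by norm_num) (by norm_num)]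
  norm_num

/-- (Ported verbatim from the HodgeCMPerL package; no docstring in the source.) -/
lemma normal_Q7 : Normal ℚ Q7 := inferInstance

/-- (Ported verbatim from the HodgeCMPerL package; no docstring in the source.) -/
lemma FK_K7 : FK K7 = Q7 := fieldRange_eq_self Q7 normal_Q7 (σ₀ K7)

/-- (Ported verbatim from the HodgeCMPerL package; no docstring in the source.) -/
lemma tagOf_FK_K7 : tagOf (FK K7) = Q7 := by
  rw [FK_K7, tagOf, normalClosure_eq_self Q7 normal_Q7]
  exact sup_eq_left.mpr le_rfl

/-- (Ported verbatim from the HodgeCMPerL package; no docstring in the source.) -/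
lemma finrank_FK_K49 : Module.finrank ℚ (FK K49) = 42 := by
  rw [finrank_FK]
  exact finrank_Q49

/-- The tags of `A_{(K₀,·)}` and `A_{(M₀,·)}` differ (degrees `6` versus `≥ 42`). -/
lemma tag_ne : tagOf (FK K7) ≠ tagOf (FK K49) := by
  intro h
  have hle : FK K49 ≤ Q7 := by
    rw [← tagOf_FK_K7, h]
    exact le_tagOf _
  have h42 : Module.finrank ℚ (FK K49) ≤ Module.finrank ℚ Q7 :=
    LinearMap.finrank_le_finrank_of_injective
      (f := (IntermediateField.inclusion hle).toLinearMap) (inclusion_injective hle)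
  rw [finrank_FK_K49, finrank_adjoin_ζ] at h42
  omega

/-! ### M38 fails in the tagged universe -/

/-- Every tagged map between the lattices of `A_{(M₀,Ψ)}` and `A_{(K₀,Φ)}` vanishes. -/
lemma lin_eq_zero (Φ : CMType K7) (Ψ : CMType K49)
    (p : (tagModel D).Mor (cmObj K49 Ψ) (cmObj K7 Φ)) : p.1.lin = 0 := by
  refine LinearMap.ext fun x => funext fun u => ?_
  have hx : x ∈ part (cmObj K7 Φ) (tagOf (FK K7)) := fun i hi => absurd rfl hi
  exact p.2 _ x hx u (Ne.symm tag_ne)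

/-- **M38 `Fact_cmInflation` FAILS in the tagged toy universe**: for `ℚ(ζ₇) ⊂ ℚ(ζ₄₉)` every tagged morphism
`A_{(ℚ(ζ₄₉),Φ^{ℚ(ζ₄₉)})} → A_{(ℚ(ζ₇),Φ)}` pulls `H¹` back by `0`, and `H¹(A_{(ℚ(ζ₄₉),·)}) ≠ 0`. -/
theorem not_fact_cmInflation : ¬ (tagModel D).Fact_cmInflation := by
  intro h
  obtain ⟨m, p, hbij, -⟩ := h K7 K49 k₀ (stdCMType K7)
  have hzero : (∑ j : Fin m, (tagModel D).pull (p j) 1 ∘ₗ LinearMap.proj j :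
      (Fin m → (tagModel D).Coh ((tagModel D).cmAV K7 (stdCMType K7)) 1) →ₗ[ℚ]
        (tagModel D).Coh ((tagModel D).cmAV K49 (inflate k₀ (stdCMType K7))) 1) = 0 := by
    refine Finset.sum_eq_zero fun j _ => ?_
    have : (tagModel D).pull (p j) 1 = 0 := by
      change map 1 (p j).1.lin = 0
      rw [lin_eq_zero D _ _ (p j), map_one_eq, LinearMap.zero_comp, LinearMap.comp_zero]
    rw [this, LinearMap.zero_comp]
  rw [hzero] at hbij
  obtain ⟨x, hx⟩ := hbij.2 ((oneEquiv ℚ (cmObj K49 (inflate k₀ (stdCMType K7))).L).symm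
    (Pi.single (M := fun _ : Unit => (FK K49 : Type)) () 1))
  rw [LinearMap.zero_apply, eq_comm, LinearEquiv.map_eq_zero_iff] at hx
  simpa using congr_fun hx ()

/-! ### The independence theorem -/

/-- `ModelAxioms ∧ ¬ M38` in the tagged exterior toy universe. -/
theorem modelAxioms_and_not_cmInflation :
    (tagModel exteriorHodgeData).ModelAxioms ∧ ¬ (tagModel exteriorHodgeData).Fact_cmInflation :=
  ⟨tagModel_modelAxioms, not_fact_cmInflation exteriorHodgeData⟩

end CMInflationIndependent

open CMInflationIndependent

/-- **M38 is independent of M1–M28**: some universe satisfies `ModelAxioms` and violates `Fact_cmInflation`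
(FACTS.md §1c row (M38), column P5). -/
theorem cmInflation_independent : ∃ U : Universe, U.ModelAxioms ∧ ¬ U.Fact_cmInflation :=
  ⟨tagModel exteriorHodgeData, modelAxioms_and_not_cmInflation⟩

/-- `ModelAxioms` does not imply M38. -/
theorem not_modelAxioms_imp_cmInflation : ¬ ∀ U : Universe, U.ModelAxioms → U.Fact_cmInflation :=
  fun h => not_fact_cmInflation exteriorHodgeData (h _ tagModel_modelAxioms)

/-- **M38 is undecided by `ModelAxioms`**: it holds in `toyModel` (`Toy.fact_cmInflation`, run 22) and fails in
the tagged toy universe; both with `ModelAxioms`. -/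
theorem cmInflation_undecided :
    (∃ U : Universe, U.ModelAxioms ∧ U.Fact_cmInflation) ∧ (∃ U : Universe, U.ModelAxioms ∧ ¬ U.Fact_cmInflation) :=
  ⟨⟨toyModel, toyModel_modelAxioms, fact_cmInflation exteriorHodgeData⟩, cmInflation_independent⟩

/-! ### Axiom closures of the headline declarations (expected: `propext`, `Classical.choice`, `Quot.sound`):
`HodgeCM.Toy.cmInflation_independent`, `HodgeCM.Toy.cmInflation_undecided`,
`HodgeCM.Toy.CMInflationIndependent.tagModel_modelAxioms`, `HodgeCM.Toy.CMInflationIndependent.not_fact_cmInflation`. -/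

end HodgeCM.Toy

end
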